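import Literature.NumberTheory.EllipticCurves.GreenbergVatsal2000.GreenbergSelmerGroups
import Literature.NumberTheory.EllipticCurves.GreenbergVatsal2000.NonPrimitiveSelmerGroup
import Literature.NumberTheory.EllipticCurves.IwasawaSelmerDualProofs
import Literature.NumberTheory.EllipticCurves.GlobalMinimalModel
import HarnessLib

/-!
# Greenberg–Vatsal, *On the Iwasawa invariants of elliptic curves* (Invent. Math. 142 (2000)),
# §2 Prop. (2.1), Cor. (2.3), Prop. (2.4) (arXiv:math/9906215 pp. 17, 20–22) AT THE DATUM:
# the non-primitive Greenberg-datum Selmer group `S^{Σ₀}_A(ℚ_∞)` versus `S_A(ℚ_∞)` — cotorsion,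
# equal `μ`, `λ(S^{Σ₀}_A) = λ(S_A) + Σ_{ℓ∈Σ₀} s_ℓ d_ℓ`, and `S^{Σ₀}_A(ℚ_∞)/S_A(ℚ_∞)` divisible — for
# `A = E[p^∞]` and ANY `G_{ℚ_p}`-stable line `C` (ONE named fact; one hypothesis structure;
# conjugation-stability and existence of the dual data PROVED)

HONEST FRAMING (BSD rank-`≤ 1` residual cell `b2b-bsdres`, home
`run/shared/lean/b2b/bsd-rank1-residual/`, team n1011 (N10/N11: X4 ∧ `p = 3`; X3♯), seat
`b2b-bsdres-n1011-lit` = the team's LITERATURE seat; file of record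
`cells/n1011/LIT-INPUTS-P3.md` §59 (B3)(5) / §60): the cell deletes the COMBINATION-SHAPED residual
classes of the rank-`≤ 1` BSD formula from PUBLISHED theorems only and TYPES the construction-shaped
ones; this is not "finishing BSD"; research routes, no claim beyond stated classes; census output is
EVIDENCE, never a Literature fact; nothing is booked by this file; no RESIDUAL-MAP mark moves.
This file records ONE published statement as a named fact (`def … : Prop`, nothing asserted;
D-0014 / D-0026: exactly one new named fact), plus ONE hypothesis structure with a body
(`DatumDualData`, the verbatim analogue of the tree's `WeierstrassCurve.SelmerDualData` /
`GreenbergVatsal2000.NonPrimitiveDualData` for the datum Selmer groups of file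
`GreenbergSelmerGroups`) whose conjugation field is PROVED here (`conjH1_mem_datumSelmer`) and
whose EXISTENCE for `A = E[p^∞]` is PROVED here (`nonempty_datumDualData`), so that the fact
quantifies over a provably non-empty type.

WHY (reach, not mathematics). The tree holds Greenberg–Vatsal's relations (6)–(7) only in the
CURVE-LEVEL, GOOD-ORDINARY form `GreenbergVatsal2000.lambda_nonPrimitive_eq_add_sum_delta`
(§1 p. 7–8, whose standing hypothesis is "`p` is a prime where `E` has good ordinary reduction",
§1 line 1) — unusable at an ADDITIVE prime. Greenberg–Vatsal print the underlying statements
(Prop. (2.1), Cor. (2.3), Prop. (2.4)) in §2 for a GENERAL ordinary datum `(V_p, T_p, W_p)` ("We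
will consider Selmer groups in a more general context than we actually need", p. 16), in
particular for `A = E[p^∞]` with ANY `G_{ℚ_p}`-stable line `C` — e.g. the RAMIFIED ordinary line of
an additive potentially ordinary prime (`EmertonPollackWeston2006.IsRamifiedOrdinaryLine`). This
datum-level record is step (5) of the kernel route (LIT-INPUTS-P3 §59 (B3)) that DISCHARGES the
composed-citation fact `GreenbergVatsal2000.muLambdaAlg_transfer_of_torsionIso_potOrd_of_not_dvd_torsionOrder`
(A240; steps (1)–(2) = team n1011 row T-E3g-GV29, `Summits/…/Additive/GreenbergVatsal*RamifiedQuotient`,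
`…/GreenbergVatsalTransferCountThree`), and from it the good-ordinary record above becomes a
corollary (with `X2/NonPrimitiveSelmerGVEquality`). Nothing here is specific to a reduction type.

## Citation header (read by this seat on the held text arXiv:math/9906215 =
## `paper:arxiv-math_9906215`, dvips stream decoded by the cell,
## `run/shared/lean/b2b/bsd-rank1-residual/b2b-bsdres-lit/u1/gv2000_decoded.txt` l.86–99;
## page numbers of the arXiv typescript; the same pages are quoted in the docstrings of
## `GreenbergSelmerGroups`, `NonPrimitiveLambdaInvariant`, `MuLambdaTransferRamifiedOrdinary`)

* §2 p. 16 (the datum): "Let `Σ` be a finite set of primes of `ℚ` containing `p` and `∞`. Suppose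
  that `Gal(ℚ_Σ/ℚ)` acts continuously and linearly on a vector space `V_p` over a field `𝓕_p`. We
  assume that `d = dim_{𝓕_p}(V_p) < ∞` and that `𝓕_p` is a finite extension of `ℚ_p`. Let `𝒪`
  denote the ring of integers of `𝓕_p`. Let `T_p` be a `Gal(ℚ_Σ/ℚ)`-invariant `𝒪`-lattice in `V_p`.
  Then `A = V_p/T_p` … If `d^±` denotes the dimension of the `(±1)`-eigenspaces for a complex
  conjugation, then `d = d⁺ + d⁻`. Fix an embedding `ℚ̄ → ℚ̄_p`. … We will assume that `V_p`
  contains an `𝓕_p`-subspace `W_p` of dimension `d⁺` which is invariant under the action of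
  `G_{ℚ_p}`. Let `C` denote the image of `W_p` in `A` … and let `D = A/C`. The Selmer group
  `S_A(ℚ_∞)` is defined by `S_A(ℚ_∞) = ker ( H¹(ℚ_Σ/ℚ_∞, A) → ∏_{ℓ∈Σ} 𝓗_ℓ(ℚ_∞, A) )` where … if
  `ℓ ≠ p`, we simply let `𝓗_ℓ(ℚ_∞, A) = ∏_{η∣ℓ} H¹((ℚ_∞)_η, A)` … `𝓗_p(ℚ_∞, A) = H¹((ℚ_∞)_𝔭, A)/L_𝔭`
  where `L_𝔭 = ker ( H¹((ℚ_∞)_𝔭, A) → H¹(I_𝔭, D) )`."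
* p. 17: "`G_{(ℚ_∞)_η}/I_η` has profinite degree prime to `p`. So the last condition is equivalent to
  `[σ|_{I_η}] = 0` … the groups `H¹(ℚ_Σ/ℚ_∞, A)`, `H²(ℚ_Σ/ℚ_∞, A)`, `𝓗_ℓ(ℚ_∞, A)`, and `S_A(ℚ_∞)`
  are discrete `𝒪`-modules with a natural action of `Γ = Gal(ℚ_∞/ℚ)`. Regarding them as
  `Λ`-modules, where `Λ = 𝒪[[Γ]]`, they are known to be cofinitely generated. … 1.
  `Corank_Λ(H¹(ℚ_Σ/ℚ_∞, A)) = d⁻ + Corank_Λ(H²(ℚ_Σ/ℚ_∞, A))`. 2. `Corank_Λ(𝓗_p(ℚ_∞)) = d⁻`. 3.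
  `Corank_Λ(𝓗_ℓ(ℚ_∞)) = 0` if `ℓ ≠ p`. In our results, we will generally assume that `S_A(ℚ_∞)`
  is `Λ`-cotorsion. … We let `A* = Hom(T_p, μ_{p^∞})` … **Proposition (2.1)** Assume that
  `S_A(ℚ_∞)` is `Λ`-cotorsion and that `H⁰(ℚ_∞, A*)` is finite. Then `γ` is surjective. *Proof.* It
  is enough to prove that `coker(γ)` is finite. The result would then follow because the Galois
  group `G_{(ℚ_∞)_η}` has `p`-cohomological dimension `1` for any prime `η` of `ℚ_∞` and so
  `𝓗_ℓ(ℚ_∞)` is a divisible group for each `l`."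
* p. 20: "Let `Σ₀` be any finite set of primes of `ℚ` which does not contain `p` or `∞`. Choose the
  set `Σ` large enough so that `Σ₀ ⊆ Σ`. The non-primitive Selmer group for `A` and `Σ₀` is defined
  by `S^{Σ₀}_A(ℚ_∞) = ker ( H¹(ℚ_Σ/ℚ_∞, A) → ∏_{ℓ∈Σ−Σ₀} 𝓗_ℓ(ℚ_∞) )`. Obviously,
  `S_A(ℚ_∞) ⊆ S^{Σ₀}_A(ℚ_∞)`. Proposition (2.1), together with the fact that `𝓗_ℓ(ℚ_∞)` is
  `Λ`-cotorsion for `ℓ ≠ p`, immediately gives the following result: **Corollary (2.3)** With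
  assumptions as in (2.1), we have `S^{Σ₀}_A(ℚ_∞)/S_A(ℚ_∞) ≅ ∏_{ℓ∈Σ₀} 𝓗_ℓ(ℚ_∞)`" (p. 21:) "as
  `Λ`-modules. Furthermore, `S^{Σ₀}_A(ℚ_∞)` is `Λ`-cotorsion and
  `corank_𝒪(S^{Σ₀}_A(ℚ_∞)) = corank_𝒪(S_A(ℚ_∞)) + Σ_{ℓ∈Σ₀} corank_𝒪(𝓗_ℓ(ℚ_∞))`. The `μ`-invariants
  of `S^{Σ₀}_A(ℚ_∞)^` and `S_A(ℚ_∞)^` are equal."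
* p. 21: "Let `s_ℓ` denote the number of primes of `ℚ_∞` lying over `ℓ` … For an odd prime `p`,
  `s_ℓ` is the largest power of `p` such that `ℓ^{p−1} ≡ 1 (mod p s_ℓ)`. … Proposition 2 of [Gre89]
  easily implies that `corank_𝒪(𝓗_ℓ(ℚ_∞)) = s_ℓ d_ℓ`. … Thus the `𝒪`-corank of `𝓗_ℓ(ℚ_∞)` is
  `deg(h_ℓ(T))`." (p. 22:) "**Proposition (2.4)** Let `P_ℓ(X) = det((1 − Frob_ℓ X)|(V_p)_{I_ℓ}) ∈
  𝒪[X]`. Let `𝒫_ℓ = P_ℓ(ℓ^{−1}γ_ℓ) ∈ Λ` … The characteristic ideal of the `Λ`-module `𝓗_ℓ(ℚ_∞)^`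
  is generated by `𝒫_ℓ`. Its `μ`-invariant is zero. Its `λ`-invariant is equal to `s_ℓ d_ℓ`. Here
  `s_ℓ` is the largest power of `p` dividing `(ℓ^{p−1} − 1)/p` and `d_ℓ` is the multiplicity of
  `X = ℓ̃^{−1}` as a root of `P̃_ℓ(X) ∈ k[X]`" — the tree's `GreenbergVatsal2000.delta W p v = s_ℓ·d_ℓ`
  (file `NonPrimitiveSelmerGroup`; GV's `P_ℓ` IS the Euler factor `W.localPolynomialAt v` by the tree
  theorem `WeierstrassCurve.reverse_charpoly_toInertiaCoinvariants_eq_localPolynomialAt`).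
* p. 26 (the case `A = E[p^∞]`): "`A = V_p/T_p` is isomorphic to `E[p^∞]` … `𝒪 = ℤ_p`,
  `d⁺ = d⁻ = 1` … Also, `H⁰(ℚ_∞, A*)` is finite since `A* ≅ E[p^∞]` by the Weil pairing and
  `E(ℚ_∞)_tors` is known to be finite."

## The tree's vocabulary (no notion re-declared)

`E/ℚ` globally minimal (`W.IsGloballyMinimal`, so that `W.localPolynomialAt v` is the Euler factor
of `E`), `A = E[p^∞] = W.geomPrimaryTorsion p` (`𝒪 = ℤ_p`, `Λ = IwasawaAlgebra p = ℤ_p⟦T⟧`), `p` ODD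
(GV §2's standing "Let `p` be an odd prime" for (2.5)/(2.8) and for the printed formula for `s_ℓ`),
`κ : ZpExtension ℚ p` CYCLOTOMIC (`ℚ_∞`) with a topological generator `γ` (`T = γ − 1`), Greenberg
data `L : GreenbergSelmer.Data ℚ A p` whose `C = (L v hv).plus` is `D_v`-stable (built into
`LocalDatum`), DIVISIBLE with `#(C ∩ A[p]) = p` — i.e. `C ≅ ℚ_p/ℤ_p` is the image of a
`G_{ℚ_p}`-invariant LINE `W_p ⊂ V_p`, `dim W_p = d⁺ = 1` (the SAME binder as the tree record
`GreenbergVatsal2000.datumSelmer_divisible_of_finite_torsionBy`); NO condition on `D = A/C`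
(ramified quotients allowed: GV §2 imposes none before Prop. (2.5)); `S^{Σ₀}_A(ℚ_∞) =
datumSelmerInfty κ A L Σ₀` and `S_A(ℚ_∞) = datumSelmerInfty κ A L ∅` (file `GreenbergSelmerGroups`);
`Σ₀` a finite set of finite places `∌ p` (no other condition: p. 20 "any finite set of primes of `ℚ`
which does not contain `p` or `∞`"); "`S_A(ℚ_∞)` is `Λ`-cotorsion" = `Module.IsTorsion Λ X.X` for a
dual datum `X` of `S_A(ℚ_∞)` (with `Module.Finite`, p. 17 "cofinitely generated"); "`H⁰(ℚ_∞, A*)` is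
finite" = `Finite (E[p^∞]^{Gal(ℚ̄/ℚ_∞)})` (`A* ≅ E[p^∞]` by the Weil pairing, p. 26; GV note it is
automatic for `E`, "`E(ℚ_∞)_tors` is known to be finite" — kept here as an explicit HYPOTHESIS, the
record is the weaker for it; tree dischargers: `finite_fixedPoints_kerSubgroup_geomPrimaryTorsion`
(`E(ℚ)[p] = 0`, any `ℤ_p`-extension), `…_of_ordinary` (good ordinary, cyclotomic));
"`corank_𝒪`" of a `Λ`-cotorsion group = the `λ`-invariant of its (finitely generated, torsion)
Pontryagin dual (p. 21 "Thus the `𝒪`-corank of `𝓗_ℓ(ℚ_∞)` is `deg(h_ℓ(T))`"; Prop. (2.4) "Its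
`λ`-invariant is equal to `s_ℓ d_ℓ`"), `lambdaInvariant` / `muInvariant` of file `IwasawaAlgebra`.

## Main definitions and results

* `conjH1_mem_unramifiedOutside`, `conjH1_mem_datumSelmer` (PROVED, any number field, any discrete
  module, any data): `S^{S₀}_M(L)` is stable under `conj_τ` for every `τ ∈ Γ_K`.
* `DatumDualData κ γ M L S₀` — Pontryagin-dual data for `S^{S₀}_M(K_∞)` (hypothesis structure with a
  body; verbatim `NonPrimitiveDualData` with `nonPrimitiveSelmerInfty` replaced by `datumSelmerInfty`).
* `datumDualData`, `nonempty_datumDualData` (PROVED): for `M = E[p^∞]` and `γ` a topological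
  generator such data EXIST (`Hom(S^{S₀}, ℚ/ℤ)` with the `Λ`-structure `IwasawaDual.IsLocNil.module`,
  exactly as `WeierstrassCurve.selmerDualData` / the cell's `X2.NonPrimitiveSelmerDual.nonPrimitiveDualData`).
* `datumSelmer_nonPrimitive_invariants` — THE NAMED FACT (GV Prop. (2.1) ⇒ Cor. (2.3) + Prop. (2.4),
  at the datum `(E[p^∞], C)`).
* `datumSelmer_nonPrimitive_invariants.mu_eq_zero_iff`, `….lambda_eq_add_sum_delta` — bookkeeping
  projections (theorems); `DatumDualData.toDualEquiv` (plumbing).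

References: R. Greenberg, V. Vatsal, Invent. Math. 142 (2000) 17–63 = arXiv:math/9906215, §2
pp. 16–17 (datum, coranks, Prop. (2.1) and its proof), pp. 20–21 (Cor. (2.3)), pp. 21–22 (`s_ℓ`,
`d_ℓ`, Prop. (2.4)), p. 26 (the case `A = E[p^∞]`); R. Greenberg, *Iwasawa theory for `p`-adic
representations*, Adv. Stud. Pure Math. 17 (1989) 97–137, Prop. 2 (structure of `𝓗_ℓ`), §§3–4
(cofinite generation) — cited BY GV, not read here.
-/

noncomputable section

open scoped Classical AddSubgroup

open NumberField IsDedekindDomain Field WeierstrassCurve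
  Literature.NumberTheory.EllipticCurves Literature.NumberTheory.EllipticCurves.GreenbergSelmer
  Literature.NumberTheory.GaloisRepresentations

universe u

namespace Literature.NumberTheory.EllipticCurves.GreenbergVatsal2000

/-! ## §1. `S^{S₀}_M(L)` is stable under conjugation (API, proved) -/

section Conj

variable {K : Type u} [Field K] [NumberField K] (H : Subgroup (absoluteGaloisGroup K)) [H.Normal]
  (M : Type u) [AddCommGroup M] [DistribMulAction (absoluteGaloisGroup K) M] [TopologicalSpace M]
  [DiscreteTopology M] (p : ℕ) (L : Data K M p) (S₀ : Set (HeightOneSpectrum (𝓞 K)))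

/-- `H¹(ℚ_Σ/ℚ_∞, A)` (the classes unramified outside `S₀ ∪ {p, ∞}` at EVERY place of `L` above
each such `v`, i.e. for every conjugate) is stable under `conj_τ`, `τ ∈ Γ_K`: the condition for
`conj_τ c` at `σ` is the condition for `c` at `στ` (`conjH1_mul_holds`). GV p. 17: these groups carry
"a natural action of `Γ = Gal(ℚ_∞/ℚ)`". [cite: GreenbergVatsal2000, §2 p. 17] -/
theorem conjH1_mem_unramifiedOutside (τ : absoluteGaloisGroup K) {c : subgroupH1 H M}
    (hc : c ∈ unramifiedOutside H M p S₀) : conjH1 H M τ c ∈ unramifiedOutside H M p S₀ := by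
  rw [mem_unramifiedOutside_iff] at hc ⊢
  intro v hv hpv σ
  have h := hc v hv hpv (σ * τ)
  rwa [Literature.NumberTheory.EllipticCurves.conjH1_mul_holds H M σ τ,
    AddMonoidHom.comp_apply] at h

/-- **`S^{S₀}_M(L)` is stable under `conj_τ` for every `τ ∈ Γ_K`** (so that `T = γ − 1` acts on it
and its Pontryagin dual is a `Λ`-module; GV p. 17 "a natural action of `Γ = Gal(ℚ_∞/ℚ)`"): both the
unramified conditions away from `p` and Greenberg's conditions above `p` are imposed at every
conjugate, and `conj_σ ∘ conj_τ = conj_{στ}` (`conjH1_mul_holds`). This discharges what is a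
hypothesis FIELD (`conj_mem`) in the sibling structures `SelmerDualData` / `NonPrimitiveDualData`.
[cite: GreenbergVatsal2000, §2 p. 17] -/
theorem conjH1_mem_datumSelmer (τ : absoluteGaloisGroup K) {c : subgroupH1 H M}
    (hc : c ∈ datumSelmer H M p L S₀) : conjH1 H M τ c ∈ datumSelmer H M p L S₀ := by
  rw [mem_datumSelmer_iff] at hc ⊢
  refine ⟨conjH1_mem_unramifiedOutside H M p S₀ τ hc.1, fun v hv σ ↦ ?_⟩
  have h := hc.2 v hv (σ * τ)
  rwa [Literature.NumberTheory.EllipticCurves.conjH1_mul_holds H M σ τ,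
    AddMonoidHom.comp_apply] at h

end Conj

/-! ## §2. Pontryagin-dual data for `S^{S₀}_M(K_∞)` (hypothesis structure) -/

section Dual

variable {K : Type u} [Field K] [NumberField K] {p : ℕ} [Fact p.Prime] (κ : ZpExtension K p)
  (γ : absoluteGaloisGroup K) (M : Type u) [AddCommGroup M]
  [DistribMulAction (absoluteGaloisGroup K) M] [TopologicalSpace M] [DiscreteTopology M]
  (L : Data K M p) (S₀ : Set (HeightOneSpectrum (𝓞 K)))

/-- **Pontryagin-dual data for the datum Selmer group `S^{S₀}_M(K_∞)`** (GV's `S^{Σ₀}_A(ℚ_∞)^`, and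
for `S₀ = ∅` GV's `S_A(ℚ_∞)^`): a `Λ = ℤ_p⟦T⟧`-module `X` with a group isomorphism
`toDual : X ≅ Hom(S^{S₀}_M(K_∞), ℚ/ℤ)` under which `T` acts as `γ − 1` (through `conjH1`, which
preserves the group: `conjH1_mem_datumSelmer`) and constants `c ∈ ℤ_p` act on `p^k`-torsion classes
through `ℤ_p → ℤ/p^k` — VERBATIM the tree's `WeierstrassCurve.SelmerDualData W κ γ` (file
`IwasawaSelmer`) / `GreenbergVatsal2000.NonPrimitiveDualData W κ γ Σ₀` (file
`NonPrimitiveSelmerGroup`) with the classical Selmer group replaced by `datumSelmerInfty κ M L S₀`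
(file `GreenbergSelmerGroups`). Intended with `κ` cyclotomic and `γ` a topological generator; for
`M = E[p^∞]` such data EXIST (`nonempty_datumDualData` below). "Regarding them as `Λ`-modules, where
`Λ = 𝒪[[Γ]]`, they are known to be cofinitely generated" (p. 17) is NOT built in: statements take
`Module.Finite` / `Module.IsTorsion` on `X` as hypotheses or conclusions.
[cite: GreenbergVatsal2000, §2 p. 17 (the `Λ`-module structure) and pp. 20–21 (`S^{Σ₀}_A(ℚ_∞)^`)] -/
structure DatumDualData where
  /-- The underlying type of the Iwasawa module `X = S^{S₀}_M(K_∞)^`. -/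
  X : Type u
  /-- `X` is an abelian group. -/
  [addCommGroup : AddCommGroup X]
  /-- `X` is a `Λ = ℤ_p⟦T⟧`-module. -/
  [module : Module (IwasawaAlgebra p) X]
  /-- The identification of `X` with the character group `Hom(S^{S₀}_M(K_∞), ℚ/ℤ)`. -/
  toDual : X →+ (datumSelmerInfty κ M L S₀ →+ AddCircle (1 : ℚ))
  /-- `toDual` is a group isomorphism. -/
  bijective : Function.Bijective toDual
  /-- `T` acts as `γ − 1`: `(T·x)(s) = x(conj_γ s) − x(s)`. -/
  toDual_T_smul : ∀ (x : X) (s : datumSelmerInfty κ M L S₀),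
    toDual ((PowerSeries.X : IwasawaAlgebra p) • x) s =
      toDual x ⟨conjH1 κ.kerSubgroup M γ s, conjH1_mem_datumSelmer κ.kerSubgroup M p L S₀ γ s.2⟩ -
        toDual x s
  /-- Constants `c ∈ ℤ_p` act on `p^k`-torsion classes through `ℤ_p → ℤ/p^k`. -/
  toDual_C_smul : ∀ (c : ℤ_[p]) (x : X) (s : datumSelmerInfty κ M L S₀) (k : ℕ),
    (p ^ k) • s = 0 →
    toDual (PowerSeries.C c • x) s = (PadicInt.toZModPow k c).val • toDual x s

attribute [instance] DatumDualData.addCommGroup DatumDualData.module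

variable {κ γ M L S₀} in
/-- Any dual datum is, as a group, the character group of `S^{S₀}_M(K_∞)`: the `AddEquiv` packaged
from `toDual` / `bijective` (as `X2.NonPrimitiveSelmerDual.toDualEquiv`). [folklore] -/
def DatumDualData.toDualEquiv (D : DatumDualData κ γ M L S₀) :
    D.X ≃+ (datumSelmerInfty κ M L S₀ →+ AddCircle (1 : ℚ)) :=
  AddEquiv.ofBijective D.toDual D.bijective

end Dual

/-! ## §3. Existence of the dual data for `M = E[p^∞]` (API, proved) -/

section Existence

variable {K : Type u} [Field K] [NumberField K] (W : WeierstrassCurve K) {p : ℕ} [Fact p.Prime]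
  (κ : ZpExtension K p) (L : Data K (W.geomPrimaryTorsion p) p)
  (S₀ : Set (HeightOneSpectrum (𝓞 K)))

/-- `conj_γ` restricted to an endomorphism of `S^{S₀}_{E[p^∞]}(K_∞)` (it preserves the group by
`conjH1_mem_datumSelmer`) — as `WeierstrassCurve.conjSelmerInfty`.
[cite: GreenbergVatsal2000, §2 p. 17] -/
def conjDatum (γ : absoluteGaloisGroup K) :
    AddMonoid.End (datumSelmerInfty κ (W.geomPrimaryTorsion p) L S₀) :=
  ((W.conjH1 p κ.kerSubgroup γ).restrict (datumSelmerInfty κ (W.geomPrimaryTorsion p) L S₀)).codRestrict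
    (datumSelmerInfty κ (W.geomPrimaryTorsion p) L S₀) fun s ↦
      conjH1_mem_datumSelmer κ.kerSubgroup (W.geomPrimaryTorsion p) p L S₀ γ s.2

/-- Unfolding `conjDatum` (definitional; private plumbing). [folklore] -/
@[simp]
private theorem coe_conjDatum_apply (γ : absoluteGaloisGroup K)
    (s : datumSelmerInfty κ (W.geomPrimaryTorsion p) L S₀) :
    ((conjDatum W κ L S₀ γ s : datumSelmerInfty κ (W.geomPrimaryTorsion p) L S₀) :
        W.subgroupH1 p κ.kerSubgroup) = W.conjH1 p κ.kerSubgroup γ s :=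
  rfl

/-- Powers: `(conjDatum γ)^m = conj_{γ^m}` on `S^{S₀}` (`conjH1_one`, `conjH1_mul`; private
plumbing). [folklore] -/
private theorem coe_conjDatum_pow_apply (γ : absoluteGaloisGroup K) (m : ℕ)
    (s : datumSelmerInfty κ (W.geomPrimaryTorsion p) L S₀) :
    ((((conjDatum W κ L S₀ γ) ^ m) s : datumSelmerInfty κ (W.geomPrimaryTorsion p) L S₀) :
        W.subgroupH1 p κ.kerSubgroup) = W.conjH1 p κ.kerSubgroup (γ ^ m) s := by
  induction m generalizing s with
  | zero => rw [pow_zero, pow_zero, AddMonoid.End.one_apply, W.conjH1_one_holds p κ.kerSubgroup,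
      AddMonoidHom.id_apply]
  | succ m ih =>
    rw [pow_succ, AddMonoid.End.coe_mul, Function.comp_apply, ih, coe_conjDatum_apply,
      pow_succ, W.conjH1_mul_holds p κ.kerSubgroup, AddMonoidHom.comp_apply]

/-- **`S^{S₀}_{E[p^∞]}(K_∞)` is `p`-primary and `T = γ − 1` is locally nilpotent on it**
(`IwasawaDual.IsLocNil`), for `γ` a topological generator: every class of `H¹(K_∞, E[p^∞])` is
killed by a power of `p` (`exists_pow_smul_subgroupH1_ker_eq_zero`) and fixed by `conj_{γ^{p^a}}`
(`exists_conjH1_pow_prime_pow_eq`), whence `(conj_γ − 1)^{k p^a} s = 0`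
(`IwasawaDual.pow_mul_prime_pow_apply_eq_zero`) — as `WeierstrassCurve.isLocNil_conjSelmerInfty_sub_one`.
[cite: GreenbergLNM1716, §1 p. 60] -/
theorem isLocNil_conjDatum_sub_one {γ : absoluteGaloisGroup K} (hγ : κ.IsTopGenerator γ) :
    IwasawaDual.IsLocNil p (conjDatum W κ L S₀ γ - 1) := by
  have htor : ∀ s : datumSelmerInfty κ (W.geomPrimaryTorsion p) L S₀, ∃ k : ℕ, p ^ k • s = 0 :=
    fun s ↦ by
    obtain ⟨k, hk⟩ := W.exists_pow_smul_subgroupH1_ker_eq_zero κ (s : W.subgroupH1 p κ.kerSubgroup)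
    exact ⟨k, Subtype.ext (by rw [AddSubgroupClass.coe_nsmul]; exact hk)⟩
  refine ⟨htor, fun s ↦ ?_⟩
  obtain ⟨a, ha⟩ := W.exists_conjH1_pow_prime_pow_eq κ hγ (s : W.subgroupH1 p κ.kerSubgroup)
  obtain ⟨k, hk⟩ := htor s
  have hφ : ((conjDatum W κ L S₀ γ) ^ p ^ a) s = s :=
    Subtype.ext (by rw [coe_conjDatum_pow_apply]; exact ha)
  exact ⟨k * p ^ a, IwasawaDual.pow_mul_prime_pow_apply_eq_zero (Fact.out : p.Prime) _ a hφ hk⟩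

/-- **The Iwasawa module `Hom(S^{S₀}_{E[p^∞]}(K_∞), ℚ/ℤ)` with its `Λ`-structure IS a
`DatumDualData`** (`T = γ − 1`, constants through `ℤ_p → ℤ/p^k`; `toDual = id`; the module structure
is `IwasawaDual.IsLocNil.module` of the tree's `IwasawaDualModule`) — the construction
`WeierstrassCurve.selmerDualData` with `Sel` replaced by `S^{S₀}_{E[p^∞]}`.
[cite: GreenbergVatsal2000, §2 p. 17] [cite: GreenbergLNM1716, §1 p. 60] -/
def datumDualData {γ : absoluteGaloisGroup K} (hγ : κ.IsTopGenerator γ) :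
    DatumDualData κ γ (W.geomPrimaryTorsion p) L S₀ :=
  { X := datumSelmerInfty κ (W.geomPrimaryTorsion p) L S₀ →+ AddCircle (1 : ℚ)
    module := (isLocNil_conjDatum_sub_one W κ L S₀ hγ).module
    toDual := AddMonoidHom.id _
    bijective := Function.bijective_id
    toDual_T_smul := fun x s ↦ by
      show (isLocNil_conjDatum_sub_one W κ L S₀ hγ).smulFun PowerSeries.X x s = x _ - x s
      rw [(isLocNil_conjDatum_sub_one W κ L S₀ hγ).smulFun_X_apply, IwasawaDual.End_sub_apply,
        AddMonoid.End.one_apply, map_sub]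
      rfl
    toDual_C_smul := fun c x s k hk ↦ by
      show (isLocNil_conjDatum_sub_one W κ L S₀ hγ).smulFun (PowerSeries.C c) x s = _
      exact (isLocNil_conjDatum_sub_one W κ L S₀ hγ).smulFun_C_apply c x hk }

/-- **Existence**: for `γ` a topological generator of `Gal(K_∞/K)`, Pontryagin-dual data for
`S^{S₀}_{E[p^∞]}(K_∞)` exist (`datumDualData`); in particular the named fact below quantifies over a
non-empty type. [cite: GreenbergLNM1716, §1 p. 60] -/
theorem nonempty_datumDualData {γ : absoluteGaloisGroup K} (hγ : κ.IsTopGenerator γ) :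
    Nonempty (DatumDualData κ γ (W.geomPrimaryTorsion p) L S₀) :=
  ⟨datumDualData W κ L S₀ hγ⟩

end Existence

/-! ## §4. THE NAMED FACT: GV Prop. (2.1) ⇒ Cor. (2.3) + Prop. (2.4) at the datum `(E[p^∞], C)` -/

/-- **Greenberg–Vatsal 2000, §2 Cor. (2.3) with Prop. (2.1) and Prop. (2.4) (arXiv:math/9906215
pp. 17, 20–22), at the datum `A = E[p^∞]`, `C` any `G_{ℚ_p}`-stable line.** Prop. (2.1) (p. 17):
"Assume that `S_A(ℚ_∞)` is `Λ`-cotorsion and that `H⁰(ℚ_∞, A*)` is finite. Then `γ` is surjective.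
*Proof.* … the Galois group `G_{(ℚ_∞)_η}` has `p`-cohomological dimension `1` for any prime `η` of
`ℚ_∞` and so `𝓗_ℓ(ℚ_∞)` is a divisible group for each `l`." Cor. (2.3) (pp. 20–21): "With
assumptions as in (2.1), we have `S^{Σ₀}_A(ℚ_∞)/S_A(ℚ_∞) ≅ ∏_{ℓ∈Σ₀} 𝓗_ℓ(ℚ_∞)` as `Λ`-modules.
Furthermore, `S^{Σ₀}_A(ℚ_∞)` is `Λ`-cotorsion and `corank_𝒪(S^{Σ₀}_A(ℚ_∞)) = corank_𝒪(S_A(ℚ_∞)) +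
Σ_{ℓ∈Σ₀} corank_𝒪(𝓗_ℓ(ℚ_∞))`. The `μ`-invariants of `S^{Σ₀}_A(ℚ_∞)^` and `S_A(ℚ_∞)^` are equal."
p. 21: "`corank_𝒪(𝓗_ℓ(ℚ_∞)) = s_ℓ d_ℓ`"; Prop. (2.4) (p. 22): "The characteristic ideal of the
`Λ`-module `𝓗_ℓ(ℚ_∞)^` is generated by `𝒫_ℓ`. Its `μ`-invariant is zero. Its `λ`-invariant is equal
to `s_ℓ d_ℓ`. Here `s_ℓ` is the largest power of `p` dividing `(ℓ^{p−1} − 1)/p` and `d_ℓ` is the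
multiplicity of `X = ℓ̃^{−1}` as a root of `P̃_ℓ(X) ∈ k[X]`"; §2 p. 16 (datum: "`V_p` contains an
`𝓕_p`-subspace `W_p` of dimension `d⁺` which is invariant under the action of `G_{ℚ_p}`. Let `C`
denote the image of `W_p` in `A`"), p. 20 ("Let `Σ₀` be any finite set of primes of `ℚ` which does
not contain `p` or `∞`"), p. 26 ("`A ≅ E[p^∞]` … `𝒪 = ℤ_p`, `d⁺ = d⁻ = 1` … `H⁰(ℚ_∞, A*)` is finite
since `A* ≅ E[p^∞]` by the Weil pairing"). TRANSCRIPTION (module docstring "the tree's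
vocabulary"): for `E/ℚ` globally minimal elliptic, an ODD prime `p`, the CYCLOTOMIC `ℤ_p`-extension
`κ` with a topological generator `γ`, Greenberg data `L` above `p` whose `C = (L v hv).plus` is
divisible with `#(C ∩ A[p]) = p` (the image of a `G_{ℚ_p}`-invariant line; NO condition on `A/C`),
`E(ℚ_∞)[p^∞] = E[p^∞]^{ker κ}` finite ("`H⁰(ℚ_∞, A*)` is finite"), a finite set `Σ₀` of finite places
`∌ p`, ANY Pontryagin-dual datum `X` of `S_A(ℚ_∞) = datumSelmerInfty κ A L ∅` whose module is
finitely generated and `Λ`-TORSION ("`S_A(ℚ_∞)` is `Λ`-cotorsion") and ANY Pontryagin-dual datum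
`X₀` of `S^{Σ₀}_A(ℚ_∞) = datumSelmerInfty κ A L Σ₀`: `X₀` is finitely generated and `Λ`-torsion
("`S^{Σ₀}_A(ℚ_∞)` is `Λ`-cotorsion"; p. 17 "cofinitely generated"), `μ(X₀) = μ(X)` ("the
`μ`-invariants … are equal"), `λ(X₀) = λ(X) + Σ_{v∈Σ₀} s_ℓ d_ℓ` (the corank identity — `corank_𝒪`
of a `Λ`-cotorsion group being the `λ`-invariant of its dual, p. 21 — with Prop. (2.4); the tree's
`delta W p v = s_ℓ·d_ℓ`), and the quotient `S^{Σ₀}_A(ℚ_∞)/S_A(ℚ_∞)` is `p`-DIVISIBLE (Cor. (2.3)'s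
isomorphism with `∏_{ℓ∈Σ₀} 𝓗_ℓ(ℚ_∞)`, each `𝓗_ℓ(ℚ_∞)` "a divisible group", p. 17). Named fact;
nothing asserted (inputs: Poitou–Tate global duality, the generalised Cassels theorem of Prop.
(2.1), Greenberg 1989 Prop. 2 / §§3–4 — none in Mathlib or proved in the tree). Nothing printed is
strengthened: the hypothesis "`H⁰(ℚ_∞, A*)` finite", automatic for `E` (p. 26), is KEPT; the
isomorphism of Cor. (2.3) is weakened to its invariants and to the divisibility of the quotient.
Flag `GV-§2-p-odd`: Prop. (2.1)/Cor. (2.3)/Prop. (2.4) carry no parity hypothesis in print except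
the displayed formula for `s_ℓ` ("For an odd prime `p`", p. 21); the record is stated for odd `p`
only (the tree's `sFactor` is that formula). Consumers: team n1011's discharge route for
`muLambdaAlg_transfer_of_torsionIso_potOrd_of_not_dvd_torsionOrder` (LIT-INPUTS-P3 §59/§60; at the
RAMIFIED ordinary line of an additive prime) and — as a corollary via
`X2/NonPrimitiveSelmerGVEquality` — the good-ordinary curve-level record
`lambda_nonPrimitive_eq_add_sum_delta`.
-- TODO(general form): GV prove (2.1)/(2.3)/(2.4) for `A = V_p/T_p` of any `p`-adic representation
-- over a finite extension `𝓕_p/ℚ_p` (any `d`, `d⁺`; `Λ_𝒪`-modules), Cor. (2.3) as a `Λ`-module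
-- ISOMORPHISM `S^{Σ₀}_A/S_A ≅ ∏_{ℓ∈Σ₀} 𝓗_ℓ(ℚ_∞)` and Prop. (2.4) as a characteristic IDEAL `(𝒫_ℓ)`;
-- only `A = E[p^∞]` (`𝒪 = ℤ_p`), the invariants and the divisibility of the quotient are
-- transcribed (the tree has no `𝓗_ℓ(ℚ_∞)` object), at odd `p`.
[cite: GreenbergVatsal2000, §2 Prop. (2.1) and proof (arXiv:math/9906215 p. 17); Cor. (2.3) (pp. 20–21); p. 21 (s_ℓ, d_ℓ, corank of 𝓗_ℓ); Prop. (2.4) (p. 22); §2 datum (p. 16); p. 20 (Σ₀); p. 26 (A = E[p^∞], A* ≅ E[p^∞])] -/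
def datumSelmer_nonPrimitive_invariants : Prop :=
  ∀ (W : WeierstrassCurve ℚ) [W.IsElliptic] [W.IsGloballyMinimal] (p : ℕ) [Fact p.Prime]
    (_hp : p ≠ 2) (κ : ZpExtension ℚ p) (_hκ : κ.IsCyclotomic) (γ : absoluteGaloisGroup ℚ)
    (_hγ : κ.IsTopGenerator γ) (L : Data ℚ (W.geomPrimaryTorsion p) p)
    (_hC : ∀ (v : HeightOneSpectrum (𝓞 ℚ)) (hv : ((p : ℕ) : 𝓞 ℚ) ∈ v.asIdeal),
      (∀ c ∈ (L v hv).plus, ∃ c' ∈ (L v hv).plus, p • c' = c) ∧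
        Nat.card ↥((L v hv).plus ⊓ (↥(W.geomPrimaryTorsion p))[(p : ℤ)]) = p)
    (_hA : Finite (FixedPoints.addSubgroup κ.kerSubgroup (W.geomPrimaryTorsion p)))
    (S₀ : Finset (HeightOneSpectrum (𝓞 ℚ))) (_hS₀ : ∀ v ∈ S₀, ((p : ℕ) : 𝓞 ℚ) ∉ v.asIdeal)
    (X : DatumDualData κ γ (W.geomPrimaryTorsion p) L (∅ : Set (HeightOneSpectrum (𝓞 ℚ))))
    [Module.Finite (IwasawaAlgebra p) X.X]
    (X₀ : DatumDualData κ γ (W.geomPrimaryTorsion p) L (↑S₀ : Set (HeightOneSpectrum (𝓞 ℚ)))),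
    Module.IsTorsion (IwasawaAlgebra p) X.X →
      Module.Finite (IwasawaAlgebra p) X₀.X ∧ Module.IsTorsion (IwasawaAlgebra p) X₀.X ∧
        muInvariant p X₀.X = muInvariant p X.X ∧
        lambdaInvariant p X₀.X = lambdaInvariant p X.X + ∑ v ∈ S₀, delta W p v ∧
        ∀ s ∈ datumSelmerInfty κ (W.geomPrimaryTorsion p) L (↑S₀ : Set (HeightOneSpectrum (𝓞 ℚ))),
          ∃ t ∈ datumSelmerInfty κ (W.geomPrimaryTorsion p) L
              (↑S₀ : Set (HeightOneSpectrum (𝓞 ℚ))),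
            p • t - s ∈ datumSelmerInfty κ (W.geomPrimaryTorsion p) L
              (∅ : Set (HeightOneSpectrum (𝓞 ℚ)))

/-! ### Bookkeeping consequences of the fact (theorems) -/

namespace datumSelmer_nonPrimitive_invariants

variable {W : WeierstrassCurve ℚ} [W.IsElliptic] [W.IsGloballyMinimal] {p : ℕ} [Fact p.Prime]
  {κ : ZpExtension ℚ p} {γ : absoluteGaloisGroup ℚ} {L : Data ℚ (W.geomPrimaryTorsion p) p}
  {S₀ : Finset (HeightOneSpectrum (𝓞 ℚ))}

/-- **`μ(S_A) = 0 ⟺ μ(S^{Σ₀}_A) = 0`** under the fact (Cor. (2.3): "The `μ`-invariants of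
`S^{Σ₀}_A(ℚ_∞)^` and `S_A(ℚ_∞)^` are equal"; the step (3) of the `μ`-transfer at a ramified
quotient). Bookkeeping. [cite: GreenbergVatsal2000, §2 Cor. (2.3) (arXiv:math/9906215 pp. 20–21)] -/
theorem mu_eq_zero_iff (h : datumSelmer_nonPrimitive_invariants) (hp : p ≠ 2)
    (hκ : κ.IsCyclotomic) (hγ : κ.IsTopGenerator γ)
    (hC : ∀ (v : HeightOneSpectrum (𝓞 ℚ)) (hv : ((p : ℕ) : 𝓞 ℚ) ∈ v.asIdeal),
      (∀ c ∈ (L v hv).plus, ∃ c' ∈ (L v hv).plus, p • c' = c) ∧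
        Nat.card ↥((L v hv).plus ⊓ (↥(W.geomPrimaryTorsion p))[(p : ℤ)]) = p)
    (hA : Finite (FixedPoints.addSubgroup κ.kerSubgroup (W.geomPrimaryTorsion p)))
    (hS₀ : ∀ v ∈ S₀, ((p : ℕ) : 𝓞 ℚ) ∉ v.asIdeal)
    (X : DatumDualData κ γ (W.geomPrimaryTorsion p) L (∅ : Set (HeightOneSpectrum (𝓞 ℚ))))
    [Module.Finite (IwasawaAlgebra p) X.X]
    (X₀ : DatumDualData κ γ (W.geomPrimaryTorsion p) L (↑S₀ : Set (HeightOneSpectrum (𝓞 ℚ))))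
    (hX : Module.IsTorsion (IwasawaAlgebra p) X.X) :
    muInvariant p X.X = 0 ↔ muInvariant p X₀.X = 0 := by
  obtain ⟨-, -, hμ, -, -⟩ := h W p hp κ hκ γ hγ L hC hA S₀ hS₀ X X₀ hX
  rw [hμ]

/-- **`λ(S^{Σ₀}_A) = λ(S_A) + Σ_{v∈Σ₀} δ_E^{(v)}`** under the fact (Cor. (2.3) + Prop. (2.4)), the
projection used by the two-curve argument (GV p. 27 line 1 with §1 (7)). Bookkeeping.
[cite: GreenbergVatsal2000, §2 Cor. (2.3), Prop. (2.4) (arXiv:math/9906215 pp. 20–22)] -/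
theorem lambda_eq_add_sum_delta (h : datumSelmer_nonPrimitive_invariants) (hp : p ≠ 2)
    (hκ : κ.IsCyclotomic) (hγ : κ.IsTopGenerator γ)
    (hC : ∀ (v : HeightOneSpectrum (𝓞 ℚ)) (hv : ((p : ℕ) : 𝓞 ℚ) ∈ v.asIdeal),
      (∀ c ∈ (L v hv).plus, ∃ c' ∈ (L v hv).plus, p • c' = c) ∧
        Nat.card ↥((L v hv).plus ⊓ (↥(W.geomPrimaryTorsion p))[(p : ℤ)]) = p)
    (hA : Finite (FixedPoints.addSubgroup κ.kerSubgroup (W.geomPrimaryTorsion p)))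
    (hS₀ : ∀ v ∈ S₀, ((p : ℕ) : 𝓞 ℚ) ∉ v.asIdeal)
    (X : DatumDualData κ γ (W.geomPrimaryTorsion p) L (∅ : Set (HeightOneSpectrum (𝓞 ℚ))))
    [Module.Finite (IwasawaAlgebra p) X.X]
    (X₀ : DatumDualData κ γ (W.geomPrimaryTorsion p) L (↑S₀ : Set (HeightOneSpectrum (𝓞 ℚ))))
    (hX : Module.IsTorsion (IwasawaAlgebra p) X.X) :
    lambdaInvariant p X₀.X = lambdaInvariant p X.X + ∑ v ∈ S₀, delta W p v :=
  (h W p hp κ hκ γ hγ L hC hA S₀ hS₀ X X₀ hX).2.2.2.1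

end datumSelmer_nonPrimitive_invariants

end Literature.NumberTheory.EllipticCurves.GreenbergVatsal2000

end
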